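import Summits.ValiantsHypothesis.ValiantsHypothesis.Theorems.BinomialElusivePeelingLemmaGadgetBranch
import Summits.ValiantsHypothesis.ValiantsHypothesis.Theorems.BinomialElusivePeelingLemmaGadgetBlockDefs

/-!
# The block theta gadget (design 3), I: the block involution; injective arms; where letters are born

Helper for the crux stmt-ValiantsHypothesis-7391 (negative lane; `Cruxes/PeelingLemma/DETERMINISTIC-ALLX.md`
§3e, module [T3]) about `blockAge` / `birthNat3` / `birth3`
(`BinomialElusivePeelingLemmaGadgetBlockDefs.lean`): `blockAge` is a parity-preserving involution
whose top blocks are ARM-SPECIFIC (`blockAge_old_arm_eq`: a letter that is old — age `≥ 2q-R` — on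
two arms forces the arms to be equal; this is requirement §3e, the property the first two designs
lack), the values of `birthNat3` range by range, `birth3_injective`, the classification
`birth3_shape`, and privacy of the ordinary / extra letters.  Part II (branch vectors) follows in
`BinomialElusivePeelingLemmaGadgetBlockBranch.lean`.  No Theses import.
-/

namespace Summit.ValiantsHypothesis.ValiantsHypothesis.Theorems.PeelingLemmaGadget

-- summit = sub-problem name (single-conjunct summit, D-0017 layout), so the namespace repeats it
set_option linter.dupNamespace false

open scoped BigOperators
open Finset
open Summit.ValiantsHypothesis.ValiantsHypothesis.Theorems.PeelingLemmaWindow (win)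

/-! ## The block involution -/

/-- `blockShift` is even. -/
theorem blockShift_mod_two (R : ℕ) (j : Fin 5) : blockShift R j % 2 = 0 := by
  unfold blockShift; rw [show (2 * R + 2) * (j : ℕ) = 2 * ((R + 1) * (j : ℕ)) by ring]; omega

/-- Distinct arms have shifts at least `2R+2` apart. -/
theorem blockShift_far (R : ℕ) {j j' : Fin 5} (h : j ≠ j') :
    blockShift R j + (2 * R + 2) ≤ blockShift R j' ∨ blockShift R j' + (2 * R + 2) ≤ blockShift R j := by
  unfold blockShift
  have hne : (j : ℕ) ≠ (j' : ℕ) := fun e => h (Fin.ext e)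
  rcases Nat.lt_or_gt_of_ne hne with hlt | hlt
  · left
    calc (2 * R + 2) * (j : ℕ) + (2 * R + 2) = (2 * R + 2) * ((j : ℕ) + 1) := by ring
      _ ≤ (2 * R + 2) * (j' : ℕ) := Nat.mul_le_mul_left _ hlt
  · right
    calc (2 * R + 2) * (j' : ℕ) + (2 * R + 2) = (2 * R + 2) * ((j' : ℕ) + 1) := by ring
      _ ≤ (2 * R + 2) * (j : ℕ) := Nat.mul_le_mul_left _ hlt

/-- Distinct arms have distinct shifts. -/
theorem blockShift_injective (R : ℕ) : Function.Injective (blockShift R) := by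
  intro j j' h
  by_contra hne
  rcases blockShift_far R hne with h' | h' <;> omega

/-- The value of `blockAge` in the admissible range `9R+8 ≤ 2q`. -/
theorem blockAge_val {q R : ℕ} (hR : 9 * R + 8 ≤ 2 * q) (j : Fin 5) (a : Fin (2 * q + 1)) :
    ((blockAge q R j a : Fin (2 * q + 1)) : ℕ) = blockSwapNat q R (blockShift R j) a := by
  unfold blockAge; rw [dif_pos hR]; rfl

/-- `blockAge` is an involution. -/
theorem blockAge_blockAge (q R : ℕ) (j : Fin 5) (a : Fin (2 * q + 1)) :
    blockAge q R j (blockAge q R j a) = a := by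
  by_cases hR : 9 * R + 8 ≤ 2 * q
  · apply Fin.ext
    rw [blockAge_val hR, blockAge_val hR]
    exact blockSwapNat_blockSwapNat q R _ (blockShift_eq_zero_or_le R j)
      (by have := blockShift_le R j; omega) a.isLt
  · unfold blockAge; rw [dif_neg hR]; rfl

/-- `blockAge` preserves parity. -/
theorem blockAge_parity (q R : ℕ) (j : Fin 5) (a : Fin (2 * q + 1)) :
    ((blockAge q R j a : Fin (2 * q + 1)) : ℕ) % 2 = (a : ℕ) % 2 := by
  by_cases hR : 9 * R + 8 ≤ 2 * q
  · rw [blockAge_val hR]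
    have h2 := blockShift_mod_two R j
    have := blockShift_le R j
    unfold blockSwapNat
    split_ifs <;> omega
  · unfold blockAge; rw [dif_neg hR]; rfl

/-- **Requirement §3e (arm-specific old blocks).**  In the admissible range, if the index `blockAge j a`
of an old age `a ≥ 2q - R` on arm `j` coincides with the index of an old age on arm `j'`, then
`j = j'`: the `R+1` oldest letters of `b` on the five arms form pairwise disjoint blocks (and, since
the closing order is the same involution, so do the `R+1` youngest letters of `b'`). -/
theorem blockAge_old_arm_eq {q R : ℕ} (hR : 9 * R + 8 ≤ 2 * q) {j j' : Fin 5}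
    {a a' : Fin (2 * q + 1)} (ha : 2 * q - R ≤ (a : ℕ)) (ha' : 2 * q - R ≤ (a' : ℕ))
    (h : blockAge q R j a = blockAge q R j' a') : j = j' := by
  by_contra hne
  have hv := congrArg Fin.val h
  rw [blockAge_val hR, blockAge_val hR] at hv
  have h1 := blockShift_le R j
  have h2 := blockShift_le R j'
  have hfar := blockShift_far R hne
  have hlt := a.isLt; have hlt' := a'.isLt
  unfold blockSwapNat at hv
  rw [if_pos ha, if_pos ha'] at hv
  omega

/-- The same, read on letters: if the letter with index `c` is old on arm `j` (its age
`blockAge j c ≥ 2q - R`, ages and indices being exchanged by the involution) and old on arm `j'`,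
then `j = j'`. -/
theorem blockAge_old_arm_eq' {q R : ℕ} (hR : 9 * R + 8 ≤ 2 * q) {j j' : Fin 5} (c : Fin (2 * q + 1))
    (hj : 2 * q - R ≤ ((blockAge q R j c : Fin (2 * q + 1)) : ℕ))
    (hj' : 2 * q - R ≤ ((blockAge q R j' c : Fin (2 * q + 1)) : ℕ)) : j = j' :=
  blockAge_old_arm_eq hR hj hj' (by rw [blockAge_blockAge, blockAge_blockAge])

variable {q R no : ℕ}

/-! ## Values of the birth sequence, range by range -/

/-- At nonnegative positions `birth3` is `birthNat3`. -/
theorem birth3_of_nonneg (j : Fin 5) {t : ℤ} (ht : 0 ≤ t) :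
    birth3 q R no j t = birthNat3 q R no j t.toNat := by
  unfold birth3; rw [if_neg (not_lt.mpr ht)]

/-- `birth3` at a natural position. -/
theorem birth3_natCast (j : Fin 5) (n : ℕ) : birth3 q R no j (n : ℤ) = birthNat3 q R no j n := by
  rw [birth3_of_nonneg j (Int.natCast_nonneg n), Int.toNat_natCast]

/-- Positions `0..2q`: the `beta` letters (in the arm's block age order). -/
theorem birthNat3_beta (j : Fin 5) {n : ℕ} (hn : n ≤ 2 * q) :
    birthNat3 q R no j n = GLetter.beta (blockAge q R j ⟨2 * q - n, by omega⟩) := by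
  unfold birthNat3; rw [dif_pos hn]

/-- Positions `2q+1..2q+no`: the ordinary births. -/
theorem birthNat3_ord (j : Fin 5) {n : ℕ} (h1 : 2 * q < n) (h2 : n ≤ 2 * q + no) :
    birthNat3 q R no j n = GLetter.ord j ⟨n - (2 * q + 1), by omega⟩ := by
  unfold birthNat3; rw [dif_neg (by omega), dif_pos h2]

/-- Position `2q+no+1`: the extra closing letter. -/
theorem birthNat3_ex (j : Fin 5) : birthNat3 q R no j (2 * q + no + 1) = GLetter.ex j := by
  unfold birthNat3; rw [dif_neg (by omega), dif_neg (by omega), if_pos rfl]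

/-- Positions `2q+no+2..4q+no+2`: the closing births and the kept letter, in block order. -/
theorem birthNat3_beta' (j : Fin 5) {n : ℕ} (h1 : 2 * q + no + 1 < n) (h2 : n ≤ 4 * q + no + 2) :
    birthNat3 q R no j n = GLetter.beta' (blockAge q R j ⟨n - (2 * q + no + 2), by omega⟩) := by
  unfold birthNat3; rw [dif_neg (by omega), dif_neg (by omega), if_neg (by omega), dif_pos h2]

/-- Beyond `b'`: junk. -/
theorem birthNat3_junk (j : Fin 5) {n : ℕ} (h : 4 * q + no + 2 < n) :
    birthNat3 q R no j n = GLetter.junk n := by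
  unfold birthNat3
  rw [dif_neg (by omega), dif_neg (by omega), if_neg (by omega), dif_neg (by omega)]

/-- Classification of the values of `birthNat3` by position. -/
theorem birthNat3_shape (j : Fin 5) (n : ℕ) :
    (n ≤ 2 * q ∧ ∃ a, birthNat3 q R no j n = GLetter.beta a) ∨
    (2 * q < n ∧ n ≤ 2 * q + no ∧ ∃ k : Fin no, (k : ℕ) = n - (2 * q + 1) ∧
        birthNat3 q R no j n = GLetter.ord j k) ∨
    (n = 2 * q + no + 1 ∧ birthNat3 q R no j n = GLetter.ex j) ∨
    (2 * q + no + 2 ≤ n ∧ n ≤ 4 * q + no + 2 ∧ ∃ a, birthNat3 q R no j n = GLetter.beta' a) ∨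
    (4 * q + no + 2 < n ∧ birthNat3 q R no j n = GLetter.junk n) := by
  by_cases h1 : n ≤ 2 * q
  · exact Or.inl ⟨h1, _, birthNat3_beta j h1⟩
  by_cases h2 : n ≤ 2 * q + no
  · exact Or.inr (Or.inl ⟨by omega, h2, ⟨n - (2 * q + 1), by omega⟩, rfl, birthNat3_ord j (by omega) h2⟩)
  by_cases h3 : n = 2 * q + no + 1
  · exact Or.inr (Or.inr (Or.inl ⟨h3, by rw [h3, birthNat3_ex]⟩))
  by_cases h4 : n ≤ 4 * q + no + 2
  · exact Or.inr (Or.inr (Or.inr (Or.inl ⟨by omega, h4, _, birthNat3_beta' j (by omega) h4⟩)))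
  · exact Or.inr (Or.inr (Or.inr (Or.inr ⟨by omega, birthNat3_junk j (by omega)⟩)))

/-! ## Injectivity of the birth sequence -/

/-- `birthNat3` has a left inverse (read off through the involution `blockAge`). -/
theorem exists_leftInverse_birthNat3 (j : Fin 5) :
    ∃ pos : GLetter q no → ℕ, ∀ n, pos (birthNat3 q R no j n) = n := by
  refine ⟨fun L => match L with
    | GLetter.beta a => 2 * q - ((blockAge q R j a : Fin (2 * q + 1)) : ℕ)
    | GLetter.ord _ k => 2 * q + 1 + (k : ℕ)
    | GLetter.ex _ => 2 * q + no + 1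
    | GLetter.beta' a => 2 * q + no + 2 + ((blockAge q R j a : Fin (2 * q + 1)) : ℕ)
    | GLetter.junk z => z.toNat, fun n => ?_⟩
  by_cases h1 : n ≤ 2 * q
  · rw [birthNat3_beta j h1]; simp only [blockAge_blockAge]; omega
  by_cases h2 : n ≤ 2 * q + no
  · rw [birthNat3_ord j (by omega) h2]; simp only; omega
  by_cases h3 : n = 2 * q + no + 1
  · subst h3; rw [birthNat3_ex]
  by_cases h4 : n ≤ 4 * q + no + 2
  · rw [birthNat3_beta' j (by omega) h4]; simp only [blockAge_blockAge]; omega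
  · rw [birthNat3_junk j (by omega)]; simp

/-- The birth sequence of an arm of the block gadget is injective. -/
theorem birth3_injective (j : Fin 5) : Function.Injective (birth3 q R no j) := by
  obtain ⟨pos, hpos⟩ := exists_leftInverse_birthNat3 (q := q) (R := R) (no := no) j
  let posZ : GLetter q no → ℤ := fun L => match L with
    | GLetter.junk z => z
    | L => (pos L : ℤ)
  have hleft : ∀ t, posZ (birth3 q R no j t) = t := by
    intro t
    by_cases ht : t < 0
    · simp only [birth3, if_pos ht, posZ]
    · rw [birth3_of_nonneg j (not_lt.mp ht)]
      have hn := hpos t.toNat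
      have ht0 : ((t.toNat : ℕ) : ℤ) = t := Int.toNat_of_nonneg (not_lt.mp ht)
      by_cases hj : 4 * q + no + 2 < t.toNat
      · rw [birthNat3_junk j hj]; simp only [posZ]; exact ht0
      · have hval : ∀ L : GLetter q no, (∀ z, L ≠ GLetter.junk z) → posZ L = (pos L : ℤ) := by
          intro L hL; cases L <;> simp only [posZ] ; exact absurd rfl (hL _)
        rw [hval _ ?_, hn, ht0]
        intro z
        rcases birthNat3_shape (q := q) (R := R) (no := no) j t.toNat with
          ⟨-, a, hb⟩ | ⟨-, -, k, -, hb⟩ | ⟨-, hb⟩ | ⟨-, -, a, hb⟩ | ⟨h5, -⟩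
        all_goals first | omega | (rw [hb]; intro h; cases h)
  intro t t' h
  have := congrArg posZ h
  rwa [hleft, hleft] at this

/-- Classification of the values of `birth3` by (integer) position. -/
theorem birth3_shape (j : Fin 5) (t : ℤ) :
    (∃ z, birth3 q R no j t = GLetter.junk z) ∨
    (0 ≤ t ∧ t ≤ 2 * q ∧ ∃ a, birth3 q R no j t = GLetter.beta a) ∨
    ((2 * q : ℤ) < t ∧ t ≤ 2 * q + no ∧ ∃ k : Fin no, (k : ℤ) = t - (2 * q + 1) ∧
        birth3 q R no j t = GLetter.ord j k) ∨
    (t = 2 * q + no + 1 ∧ birth3 q R no j t = GLetter.ex j) ∨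
    ((2 * q + no + 2 : ℤ) ≤ t ∧ t ≤ 4 * q + no + 2 ∧ ∃ a, birth3 q R no j t = GLetter.beta' a) := by
  by_cases ht : t < 0
  · exact Or.inl ⟨t, by simp only [birth3, if_pos ht]⟩
  rw [birth3_of_nonneg j (not_lt.mp ht)]
  have ht0 : ((t.toNat : ℕ) : ℤ) = t := Int.toNat_of_nonneg (not_lt.mp ht)
  rcases birthNat3_shape (q := q) (R := R) (no := no) j t.toNat with
    ⟨h1, a, ha⟩ | ⟨h1, h2, k, hk, hb⟩ | ⟨h1, hb⟩ | ⟨h1, h2, a, ha⟩ | ⟨-, hb⟩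
  · exact Or.inr (Or.inl ⟨by omega, by omega, a, ha⟩)
  · exact Or.inr (Or.inr (Or.inl ⟨by omega, by omega, k, by omega, hb⟩))
  · exact Or.inr (Or.inr (Or.inr (Or.inl ⟨by omega, hb⟩)))
  · exact Or.inr (Or.inr (Or.inr (Or.inr ⟨by omega, by omega, a, ha⟩)))
  · exact Or.inl ⟨_, hb⟩

/-- Ordinary letters are private: `ord j k` is born only on arm `j`, at position `2q + 1 + k`. -/
theorem birth3_eq_ord_iff (j j' : Fin 5) (t : ℤ) (k : Fin no) :
    birth3 q R no j t = GLetter.ord j' k ↔ j = j' ∧ t = 2 * q + 1 + (k : ℕ) := by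
  constructor
  · intro h
    rcases birth3_shape (q := q) (R := R) (no := no) j t with
      ⟨z, hb⟩ | ⟨-, -, a, hb⟩ | ⟨-, -, k', hk', hb⟩ | ⟨-, hb⟩ | ⟨-, -, a, hb⟩ <;> rw [hb] at h <;> cases h
    exact ⟨rfl, by omega⟩
  · rintro ⟨rfl, rfl⟩
    rw [show (2 * q + 1 + (k : ℕ) : ℤ) = ((2 * q + 1 + (k : ℕ) : ℕ) : ℤ) by push_cast; ring,
      birth3_natCast, birthNat3_ord j (by omega) (by omega)]
    congr 1; exact Fin.ext (by simp)

/-- Extra letters are private: `ex j` is born only on arm `j`, at position `2q + no + 1`. -/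
theorem birth3_eq_ex_iff (j j' : Fin 5) (t : ℤ) :
    birth3 q R no j t = GLetter.ex j' ↔ j = j' ∧ t = 2 * q + no + 1 := by
  constructor
  · intro h
    rcases birth3_shape (q := q) (R := R) (no := no) j t with
      ⟨z, hb⟩ | ⟨-, -, a, hb⟩ | ⟨-, -, k', -, hb⟩ | ⟨h1, hb⟩ | ⟨-, -, a, hb⟩ <;> rw [hb] at h <;> cases h
    exact ⟨rfl, h1⟩
  · rintro ⟨rfl, rfl⟩
    rw [show (2 * q + no + 1 : ℤ) = ((2 * q + no + 1 : ℕ) : ℤ) by push_cast; ring, birth3_natCast,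
      birthNat3_ex]

/-- `beta a` is born on arm `j` exactly at position `2q - blockAge j a` (its age at `b` is
`blockAge j a`). -/
theorem birth3_eq_beta_iff (j : Fin 5) (t : ℤ) (a : Fin (2 * q + 1)) :
    birth3 q R no j t = GLetter.beta a ↔
      t = 2 * q - (((blockAge q R j a : Fin (2 * q + 1)) : ℕ) : ℤ) := by
  have hlt := (blockAge q R j a).isLt
  constructor
  · intro h
    rcases birth3_shape (q := q) (R := R) (no := no) j t with
      ⟨z, hb⟩ | ⟨h0, h1, -, -⟩ | ⟨-, -, k', -, hb⟩ | ⟨-, hb⟩ | ⟨-, -, a', hb⟩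
    all_goals try (rw [hb] at h; cases h)
    have ht : t = ((t.toNat : ℕ) : ℤ) := (Int.toNat_of_nonneg h0).symm
    rw [ht, birth3_natCast, birthNat3_beta j (by omega)] at h
    have h2 := GLetter.beta.inj h
    have h3 : blockAge q R j (blockAge q R j ⟨2 * q - t.toNat, by omega⟩) = blockAge q R j a := by
      rw [h2]
    rw [blockAge_blockAge] at h3
    have h4 := congrArg Fin.val h3
    simp only at h4
    omega
  · intro ht
    have ht' : t = ((2 * q - ((blockAge q R j a : Fin (2 * q + 1)) : ℕ) : ℕ) : ℤ) := by
      rw [ht]; push_cast [Nat.cast_sub (show ((blockAge q R j a : Fin (2 * q + 1)) : ℕ) ≤ 2 * q by omega)]; ring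
    rw [ht', birth3_natCast, birthNat3_beta j (by omega)]
    congr 1
    have : (⟨2 * q - (2 * q - ((blockAge q R j a : Fin (2 * q + 1)) : ℕ)), by omega⟩ : Fin (2 * q + 1))
        = blockAge q R j a := Fin.ext (by simp only; omega)
    rw [this, blockAge_blockAge]

/-- `beta' a` is born on arm `j` exactly at position `2q + no + 2 + blockAge j a` (its age at `b'`
is `2q - blockAge j a`). -/
theorem birth3_eq_beta'_iff (j : Fin 5) (t : ℤ) (a : Fin (2 * q + 1)) :
    birth3 q R no j t = GLetter.beta' a ↔
      t = 2 * q + no + 2 + (((blockAge q R j a : Fin (2 * q + 1)) : ℕ) : ℤ) := by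
  have hlt := (blockAge q R j a).isLt
  constructor
  · intro h
    rcases birth3_shape (q := q) (R := R) (no := no) j t with
      ⟨z, hb⟩ | ⟨-, -, a', hb⟩ | ⟨-, -, k', -, hb⟩ | ⟨-, hb⟩ | ⟨h0, h1, -, -⟩
    all_goals try (rw [hb] at h; cases h)
    have ht : t = ((t.toNat : ℕ) : ℤ) := (Int.toNat_of_nonneg (by omega)).symm
    rw [ht, birth3_natCast, birthNat3_beta' j (by omega) (by omega)] at h
    have h2 := GLetter.beta'.inj h
    have h3 : blockAge q R j (blockAge q R j ⟨t.toNat - (2 * q + no + 2), by omega⟩) =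
        blockAge q R j a := by rw [h2]
    rw [blockAge_blockAge] at h3
    have h4 := congrArg Fin.val h3
    simp only at h4
    omega
  · intro ht
    have ht' : t = ((2 * q + no + 2 + ((blockAge q R j a : Fin (2 * q + 1)) : ℕ) : ℕ) : ℤ) := by
      rw [ht]; push_cast; ring
    rw [ht', birth3_natCast, birthNat3_beta' j (by omega) (by omega)]
    congr 1
    have : (⟨2 * q + no + 2 + ((blockAge q R j a : Fin (2 * q + 1)) : ℕ) - (2 * q + no + 2), by omega⟩ :
        Fin (2 * q + 1)) = blockAge q R j a := Fin.ext (by simp only; omega)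
    rw [this, blockAge_blockAge]

end Summit.ValiantsHypothesis.ValiantsHypothesis.Theorems.PeelingLemmaGadget
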